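import Summits.CriticalPhenomena.PercolationContinuityZ3.Theses.PercMinContact
import Literature.Probability.Percolation.PercolationProofs
import Literature.Probability.LatticeModels.ProductMeasureTools

/-!
# Route `PercMinContact`, item `LogMomentConverse` (stmt-CriticalPhenomena-11501) — part 2:
# the monotone coupling and the resampling ("compensator") inequality

Def-free helper lemmas for the proof of
`Summit.CriticalPhenomena.PercolationContinuityZ3.Theses.PercMinContact.LogMomentConverse`,
general vertex type `V` and graph `G`. In the monotone coupling (`labelMeasure V` = i.i.d. uniform
labels `U`, `configOfLabels t U G = {f ∈ E(G) | U f ≤ t}`, law `P_t` by `map_configOfLabels_holds`)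
write `η_t^{-e}(U) := configOfLabels t U G \ {e}` for the level-`t` configuration with the edge `e`
closed; it does not depend on the label `U e` (`configOfLabels_update_diff`). For a measurable event
`A` of configurations:

* `P_t {ω | ω \ {e} ∈ A} = Λ {U | η_t^{-e}(U) ∈ A}` (`bondPercolation_preimage_diff_eq`);
* **resampling inequality** (`setLIntegral_level_le_labelMeasure`): for `p_c ≤ 1`,
  `∫_{t ∈ (0, p_c)} Λ {U | η_t^{-e}(U) ∈ A} dt ≤ Λ {U | U e < p_c ∧ η_{U e}^{-e}(U) ∈ A}`.
  Proof: resample the label of `e` — replacing `U e` by an independent uniform `t` preserves `Λ`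
  (`Literature.Probability.LatticeModels.map_update_infinitePi_prod`), so the right-hand side is
  `(Λ ⊗ Leb_[0,1]) {(U, t) | t < p_c ∧ η_t^{-e}(U) ∈ A} = ∫_{[0,1]} Λ{U | t < p_c ∧ η_t^{-e}(U) ∈ A} dt`
  (Tonelli, `Measure.prod_apply_symm`), which dominates the integral over `(0, p_c) ⊆ [0, 1]`.

This is the "label of `e` independent of the other labels; Tonelli" step of the item's paper proof
(card C3 of the route), in inequality form (the factor `(1 - u)⁻¹ ≥ 1` of the compensator identity
is simply dropped). Also: the measurability in `t` of `t ↦ Λ {U | η_t^{-e}(U) ∈ A}`.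

References: Grimmett 1999 §1.3 p. 11 (the coupling); the route's card C3.
-/

noncomputable section

namespace Summit.CriticalPhenomena.PercolationContinuityZ3.Theorems

namespace PercMinContactLMC

open MeasureTheory Literature.Probability.Percolation
open scoped ENNReal

variable {V : Type*}

/-! ### The configuration with one edge closed -/

/-- `η_t^{-e}(U) = configOfLabels t U G \ {e}` does not depend on the label of `e`. [folklore] -/
theorem configOfLabels_update_diff [DecidableEq V] (G : SimpleGraph V) (e : Sym2 V) (t s : ℝ)
    (U : Sym2 V → ℝ) :
    configOfLabels t (Function.update U e s) G \ {e} = configOfLabels t U G \ {e} := by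
  ext f
  simp only [configOfLabels, Set.mem_sdiff, Set.mem_setOf_eq, Set.mem_singleton_iff]
  constructor
  · rintro ⟨⟨hf, hU⟩, hne⟩
    rw [Function.update_of_ne hne] at hU
    exact ⟨⟨hf, hU⟩, hne⟩
  · rintro ⟨⟨hf, hU⟩, hne⟩
    exact ⟨⟨hf, by rwa [Function.update_of_ne hne]⟩, hne⟩

/-- Joint measurability of `(U, t) ↦ η_t^{-e}(U)`. [folklore] -/
theorem measurable_configOfLabels_diff_uncurry (G : SimpleGraph V) (e : Sym2 V) :
    Measurable fun q : (Sym2 V → ℝ) × ℝ => configOfLabels q.2 q.1 G \ {e} := by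
  refine measurable_set_iff.2 fun f => ?_
  change Measurable fun q : (Sym2 V → ℝ) × ℝ => (f ∈ G.edgeSet ∧ q.1 f ≤ q.2) ∧ f ∉ ({e} : Set (Sym2 V))
  exact (measurable_const.and (measurableSet_setOf.1
    (measurableSet_le ((measurable_pi_apply f).comp measurable_fst) measurable_snd))).and
    measurable_const

/-- Measurability of `U ↦ η_{U e}^{-e}(U)` (level = the label of `e` itself). [folklore] -/
theorem measurable_configOfLabels_diff_self (G : SimpleGraph V) (e : Sym2 V) :
    Measurable fun U : Sym2 V → ℝ => configOfLabels (U e) U G \ {e} :=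
  (measurable_configOfLabels_diff_uncurry G e).comp (measurable_id.prodMk (measurable_pi_apply e))

/-- The map `ω ↦ ω \ {e}` (closing the edge `e`) is measurable. [folklore] -/
theorem measurable_diff_singleton (e : Sym2 V) :
    Measurable fun ω : BondConfig V => ω \ {e} :=
  measurable_set_iff.2 fun f => (measurable_set_mem f).and measurable_const

/-- `t ↦ Λ {U | η_t^{-e}(U) ∈ A}` is measurable (a section measure of a measurable subset of the
product `(labels) × (levels)`). [folklore] -/
theorem measurable_labelMeasure_level (G : SimpleGraph V) (e : Sym2 V) {A : Set (BondConfig V)}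
    (hA : MeasurableSet A) :
    Measurable fun t : ℝ => labelMeasure V ((fun U : Sym2 V → ℝ => configOfLabels t U G \ {e}) ⁻¹' A) := by
  have hΛ : IsProbabilityMeasure (labelMeasure V) := isProbabilityMeasure_labelMeasure V
  exact measurable_measure_prodMk_right (μ := labelMeasure V)
    (hA.preimage (measurable_configOfLabels_diff_uncurry G e))

/-! ### The coupling identity with one edge closed -/

/-- **Coupling with the edge `e` closed**: `P_p {ω | ω \ {e} ∈ A} = Λ {U | η_p^{-e}(U) ∈ A}`
(`map_configOfLabels_holds`). [folklore] -/
theorem bondPercolation_preimage_diff_eq [Countable V] (G : SimpleGraph V) (p : unitInterval)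
    (e : Sym2 V) {A : Set (BondConfig V)} (hA : MeasurableSet A) :
    bondPercolation G p ((fun ω : BondConfig V => ω \ {e}) ⁻¹' A) =
      labelMeasure V ((fun U : Sym2 V → ℝ => configOfLabels (p : ℝ) U G \ {e}) ⁻¹' A) := by
  rw [← map_configOfLabels_holds G p,
    Measure.map_apply (measurable_configOfLabels _ G) (hA.preimage (measurable_diff_singleton e))]
  rfl

/-! ### Resampling the label of one edge -/

/-- **Resampling inequality** (the compensator step of the item's proof, inequality form): for a
measurable event `A`, an edge `e` and `p_c ≤ 1`,
`∫_{t ∈ (0, p_c)} Λ{U | η_t^{-e}(U) ∈ A} dt ≤ Λ{U | U e < p_c ∧ η_{U e}^{-e}(U) ∈ A}`: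
the label `U e` is uniform and independent of `η_·^{-e}(U)`
(`Literature.Probability.LatticeModels.map_update_infinitePi_prod` + Tonelli). [folklore] -/
theorem setLIntegral_level_le_labelMeasure [Countable V] [DecidableEq V] (G : SimpleGraph V)
    (e : Sym2 V) {A : Set (BondConfig V)} (hA : MeasurableSet A) {pc : ℝ} (hpc : pc ≤ 1) :
    ∫⁻ t in Set.Ioo 0 pc, labelMeasure V ((fun U : Sym2 V → ℝ => configOfLabels t U G \ {e}) ⁻¹' A) ≤
      labelMeasure V {U : Sym2 V → ℝ | U e < pc ∧ configOfLabels (U e) U G \ {e} ∈ A} := by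
  have hν : IsProbabilityMeasure ((volume : Measure ℝ).restrict (Set.Icc (0 : ℝ) 1)) :=
    isProbabilityMeasure_volume_restrict_unitInterval
  have hΛ : IsProbabilityMeasure (labelMeasure V) := isProbabilityMeasure_labelMeasure V
  set S : Set (Sym2 V → ℝ) := {U | U e < pc ∧ configOfLabels (U e) U G \ {e} ∈ A} with hS
  have hSm : MeasurableSet S :=
    (measurableSet_lt (measurable_pi_apply e) measurable_const).inter
      (hA.preimage (measurable_configOfLabels_diff_self G e))
  set R : Set ((Sym2 V → ℝ) × ℝ) := {q | q.2 < pc ∧ configOfLabels q.2 q.1 G \ {e} ∈ A} with hR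
  have hRm : MeasurableSet R :=
    (measurableSet_lt measurable_snd measurable_const).inter
      (hA.preimage (measurable_configOfLabels_diff_uncurry G e))
  -- resampling the label of `e` preserves `Λ`
  have hmap := Literature.Probability.LatticeModels.map_update_infinitePi_prod
    (fun _ : Sym2 V => (volume : Measure ℝ).restrict (Set.Icc (0 : ℝ) 1)) e
  have hpre : (fun q : (Sym2 V → ℝ) × ℝ => Function.update q.1 e q.2) ⁻¹' S = R := by
    ext ⟨U, t⟩
    simp only [Set.mem_preimage, hS, hR, Set.mem_setOf_eq, Function.update_self,
      configOfLabels_update_diff]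
  have h1 : labelMeasure V S =
      ((labelMeasure V).prod ((volume : Measure ℝ).restrict (Set.Icc (0 : ℝ) 1))) R := by
    have h := congrArg (fun μ : Measure (Sym2 V → ℝ) => μ S) hmap
    rw [Measure.map_apply measurable_update' hSm, hpre] at h
    exact h.symm
  rw [h1, Measure.prod_apply_symm hRm]
  have hsub : Set.Ioo 0 pc ⊆ Set.Icc (0 : ℝ) 1 := fun t ht => ⟨ht.1.le, ht.2.le.trans hpc⟩
  calc ∫⁻ t in Set.Ioo 0 pc, labelMeasure V ((fun U : Sym2 V → ℝ => configOfLabels t U G \ {e}) ⁻¹' A)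
      = ∫⁻ t in Set.Ioo 0 pc, labelMeasure V ((fun U : Sym2 V → ℝ => (U, t)) ⁻¹' R) := by
        refine setLIntegral_congr_fun measurableSet_Ioo (fun t ht => ?_)
        congr 1
        ext U
        simp only [Set.mem_preimage, hR, Set.mem_setOf_eq, ht.2, true_and]
    _ ≤ ∫⁻ t in Set.Icc 0 1, labelMeasure V ((fun U : Sym2 V → ℝ => (U, t)) ⁻¹' R) :=
        lintegral_mono_set hsub

end PercMinContactLMC

end Summit.CriticalPhenomena.PercolationContinuityZ3.Theorems

end
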